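import Summits.BirchSwinnertonDyer.BirchSwinnertonDyer.Theorems.QuadraticBranchSignedControlPlusEtaNonsurjPrimeLFunctionRecordsByName
import Summits.BirchSwinnertonDyer.BirchSwinnertonDyer.Theorems.QuadraticBranchSignedControlPlusEtaNonsurjModFiveCongruenceRecordsB
import HarnessLib

/-!
# Route `QuadraticBranchSignedControl` (rung K8, cell `bsd-potss`), residual crux `PlusEtaMainConjectureNonsurj`
# (stmt-BirchSwinnertonDyer-19606): the 9 unit-anchored non-CM RANK-ONE records BY NAME (k8eta-c2 g5) RE-ISSUED with the
# mod-`5` congruence FROM PRINT — Fisher's Hesse families as the landed named facts instead of the displayed binder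
# `ModPCongruent V′ V 5` — part A of the re-issue: the 5 rows anchored at `900b1` / `3600bb1` (seat `bsd-potss-k8eta-c2` g8; `--supports` helper; ROUTE-FREE; nothing booked, BSD is not proved by any of this)

WHAT. Seat g5's records `EtaPrimeRoadRecordsByName.etaMC_r1_<W>_<W′>_5` (p520295) settle (C1⁺_η)(V,5) for every good `a_5 = 0`
globally minimal model `V` of the `5`-twist of the nine non-CM rank-one rows of crux 19606 below `5·10⁵` with a CM UNIT anchor —
26100h1 ~ 900b1, 104400dc1 ~ 3600bb1, 243900o1 ~ 900b1, 243900p1 ~ 900b1, 313200el1 ~ 10800cj1, 341775ca1 ~ 11025e1,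
341775dj1 ~ 11025e1, 417600ke1 ~ 14400cz1, 458100j1 ~ 900b1 — modulo the named facts `h22 h41 h46 hmod hGZK hS28` and, per
row, the DISPLAYED congruence `ModPCongruent V′ V 5` between the chosen models of the two `5`-twists (evidence: Kraus–Oesterlé
trace certificate, kit j270714), the PARI shape `(L_5⁺(V,η,X)) = (X)` and Cremona's `r_an`, `#Ш_an`. Seat `bsd-potss-conjA-anchor`
g7 typed Fisher's two families of `5`-congruent curves as NAMED PUBLISHED FACTS (`HesseFamilyFive.thm132_…` / `thm58_…`,
p543671 / p545896) and this seat's `EtaModFiveCongruenceRecords` (part B) proves `ModPCongruent V′ V 5` for ALL models of the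
two twists of each pair modulo ONE of them (kernel certificate on the tree's `quadraticTwist` models + `congr_of_smul_eq`).
THIS FILE re-issues the nine records with that binder DISCHARGED (ns `EtaPrimeRoadRecordsFisher`, names `<original>_fisher`).

AFTER THIS FILE each of the nine rows is settled per row modulo NAMED PUBLISHED FACTS ONLY (`h22`, `h41`, `h46`, `hmod`, `hGZK`,
`hS28`, + ONE Fisher fact `hF`) + the displayed PARI shape `(L_5⁺(V,η,X)) = (X)` (whose vanishing half `L_5⁺(V,η,0) = 0` is a
theorem from `r_an(W) = 1`, g5 p519138) + Cremona's displayed `r_an(W) = 1`, `r_an(W′) = 0`, `#Ш_an(W′) = 1`. No numerical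
EVIDENCE remains in hypothesis position for the congruence.

HONEST FRAMING (cell `bsd-potss`; HUMAN RULING D-0036/D-0074): BOOKKEEPING THEOREMS ONLY — no definition, no new fact, no
`sorry`, axioms standard; CONDITIONAL on the named facts in hypothesis position. 19606 stays OPEN; nothing is booked;
BSD(W,5) is claimed for no pair; no label / mark / count moves. `--supports stmt-BirchSwinnertonDyer-19606`.

References: [Fisher2012Hessian] Thm. 13.2; [Fisher2013TwistsOfX5] Thm. 5.8; [HatleyLei2019] Thm. 4.6 (§4.2); [Kobayashi2003]
Thm. 2.2 (p. 5), §4 + Thm. 4.1 (p. 8); [BurungaleFlach2024] Thm. 1.1, Cor. 2; [Cremona1997] Table 1.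
-/

set_option autoImplicit false
set_option linter.dupNamespace false

noncomputable section

open scoped Classical

open CongruenceSubgroup Field Function NumberField IsDedekindDomain WeierstrassCurve
open Literature.NumberTheory.EllipticCurves
open Literature.NumberTheory.EllipticCurves.ModularForms
open Literature.NumberTheory.EllipticCurves.Rank1Residual
open Literature.NumberTheory.EllipticCurves.Rank1Residual.Typed
open Literature.NumberTheory.EllipticCurves.Rank1Residual.X11RankOneCertificates
open Literature.NumberTheory.GaloisRepresentations
open Literature.NumberTheory.GaloisCohomology
open Literature.NumberTheory.EllipticCurves.IwasawaAlgebra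
open Literature.NumberTheory.EllipticCurves.IwasawaDual ZpExtension
open Literature.NumberTheory.EllipticCurves.GreenbergVatsal2000
open Literature.NumberTheory.EllipticCurves.HesseFamilyFive (thm132_geomTorsionFive_of_hesseFamily
  thm58_geomTorsionFive_of_dualHesseFamily)
open Summit.BirchSwinnertonDyer.Rank1Residual.X11b.Levels
open Summit.BirchSwinnertonDyer.Rank1Residual.X11b
open Summit.BirchSwinnertonDyer.Rank1Residual.Additive
open Summit.BirchSwinnertonDyer.Rank1Residual.Additive.SignedTwist
open scoped ContRepresentation
open Summit.BirchSwinnertonDyer.Rank1Residual.AdditivePotMult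
open Summit.BirchSwinnertonDyer.Rank1Residual.O6 (ModPCongruent)

namespace Summit.BirchSwinnertonDyer.BirchSwinnertonDyer.Theorems

namespace EtaPrimeRoadRecordsFisher

set_option maxRecDepth 100000 in
/-- **`etaMC_r1_26100h1_900b1_5_fisher`, the congruence from print** — the record
`EtaPrimeRoadRecordsByName.etaMC_r1_26100h1_900b1_5` (k8eta-c2 g4/g5: (C1⁺_η) at `p = 5` for every good `a_5 = 0` globally
minimal model `V` of the `5`-twist of the non-CM rank-`1` row `26100h1`, through the CM unit anchor `900b1`, Hatley–Lei by name)
with its displayed binder `ModPCongruent V′ V 5` DISCHARGED for all models `V′`, `V` of the two `5`-twists: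
`EtaModFiveCongruenceRecords.modPCongruent_twist5_900b1_26100h1 hF …` — the twisted row is the point `(λ:μ) = (150 : 1)` of the
INDIRECT Hesse family of the twisted anchor, `v = 1/73811250000000000000` (kernel certificate; models by `congr_of_smul_eq`). So
this row is settled per row modulo NAMED PUBLISHED FACTS ONLY (`h22 h41 h46 hmod hGZK hS28` + Fisher's
`thm58_geomTorsionFive_of_dualHesseFamily`) + the displayed PARI shape `(L_5⁺(V,η,X)) = (X)` + Cremona's `r_an`, `#Ш_an`. Other
binders, conclusion and honest framing VERBATIM those of the original (CONDITIONAL; per row; nothing booked; BSD for no pair).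
[cite: Fisher2013TwistsOfX5, Thm. 5.8] [cite: HatleyLei2019, Thm. 4.6 (§4.2)] [cite: Kobayashi2003, §4 (p. 8)]
[cite: Cremona1997, Table 1 (labels 26100h1, 900b1)] -/
theorem etaMC_r1_26100h1_900b1_5_fisher (hF : thm58_geomTorsionFive_of_dualHesseFamily)
    (h22 : Kobayashi2003.thm22_etaSignedSelmerDual_finite_torsion)
    (h41 : Kobayashi2003.thm41_plusEtaCharIdeal_dvd)
    (hmod : hasEntireLFunction_rat) (hGZK : rank_eq_analyticRank_of_analyticRank_le_one)
    (hS28 : bsdTriple_of_hasCM_of_L_one_ne_zero)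
    (h46 : HatleyLei2019.thm46_etaSignedMu_eq_zero_iff_of_torsionIso) [Fact (5 : ℕ).Prime]
    (W' : WeierstrassCurve ℚ) (hW' : W' = ⟨0, 0, 0, 0, 125⟩) (hr' : W'.analyticRank = 0)
    (hs' : shaAn W' = ((1 : ℕ) : ℂ))
    (W : WeierstrassCurve ℚ) (hW : W = ⟨0, 0, 0, -8625, 644625⟩) (hr : W.analyticRank = 1) :
    ∀ (V' : WeierstrassCurve ℚ) [V'.IsElliptic] [V'.IsGloballyMinimal]
      (V : WeierstrassCurve ℚ) [V.IsElliptic] [V.IsGloballyMinimal],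
      (∃ C' : VariableChange ℚ, C' • W'.quadraticTwist (5) = V') →
      V'.HasGoodReductionAtPrime 5 → V'.frobeniusTrace 5 = 0 →
      (∃ C : VariableChange ℚ, C • W.quadraticTwist (5) = V) →
      V.HasGoodReductionAtPrime 5 → V.frobeniusTrace 5 = 0 →
      (∀ {N : ℕ} [NeZero N] {f : CuspForm (Gamma0 N) 2}, IsNewformOf V f →
        ∀ (ϖ : ℚ), (if Even (5 / 2) then (ϖ : ℝ) * V.realPeriodRat = plusPeriod f
            else (ϖ : ℝ) * V.imaginaryPeriodRat = minusPeriod f) →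
        ∀ (Lη : IwasawaAlgebra 5), IsQuadraticBranchPlusLFunction f 5 ϖ Lη →
          Ideal.span {Lη} = Ideal.span {(PowerSeries.X : IwasawaAlgebra 5)}) →
        QuadraticBranchPlusEtaMainConjectureAt V 5 := by
  intro V' _ _ V _ _ hC' hg' ha' hC hg ha hX
  have hcong : ModPCongruent V' V 5 := by
    subst hW'; subst hW
    haveI := EtaCMUnitRecords.isElliptic_900b1
    haveI := EtaPrimeRoadRecords.isElliptic_26100h1
    exact EtaModFiveCongruenceRecords.modPCongruent_twist5_900b1_26100h1 hF _ _ rfl rfl V' V hC' hC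
  exact EtaPrimeRoadRecordsByName.etaMC_r1_26100h1_900b1_5 h22 h41 hmod hGZK hS28 h46 W' hW' hr' hs' W hW hr V' V hC' hg' ha' hC hg ha hcong hX

set_option maxRecDepth 100000 in
/-- **`etaMC_r1_104400dc1_3600bb1_5_fisher`, the congruence from print** — the record
`EtaPrimeRoadRecordsByName.etaMC_r1_104400dc1_3600bb1_5` (k8eta-c2 g4/g5: (C1⁺_η) at `p = 5` for every good `a_5 = 0` globally
minimal model `V` of the `5`-twist of the non-CM rank-`1` row `104400dc1`, through the CM unit anchor `3600bb1`, Hatley–Lei by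
name) with its displayed binder `ModPCongruent V′ V 5` DISCHARGED for all models `V′`, `V` of the two `5`-twists:
`EtaModFiveCongruenceRecords.modPCongruent_twist5_3600bb1_104400dc1 hF …` — the twisted row is the point `(λ:μ) = (-150 : 1)` of
the INDIRECT Hesse family of the twisted anchor, `v = 1/73811250000000000000` (kernel certificate; models by
`congr_of_smul_eq`). So this row is settled per row modulo NAMED PUBLISHED FACTS ONLY (`h22 h41 h46 hmod hGZK hS28` + Fisher's
`thm58_geomTorsionFive_of_dualHesseFamily`) + the displayed PARI shape `(L_5⁺(V,η,X)) = (X)` + Cremona's `r_an`, `#Ш_an`. Other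
binders, conclusion and honest framing VERBATIM those of the original (CONDITIONAL; per row; nothing booked; BSD for no pair).
[cite: Fisher2013TwistsOfX5, Thm. 5.8] [cite: HatleyLei2019, Thm. 4.6 (§4.2)] [cite: Kobayashi2003, §4 (p. 8)]
[cite: Cremona1997, Table 1 (labels 104400dc1, 3600bb1)] -/
theorem etaMC_r1_104400dc1_3600bb1_5_fisher (hF : thm58_geomTorsionFive_of_dualHesseFamily)
    (h22 : Kobayashi2003.thm22_etaSignedSelmerDual_finite_torsion)
    (h41 : Kobayashi2003.thm41_plusEtaCharIdeal_dvd)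
    (hmod : hasEntireLFunction_rat) (hGZK : rank_eq_analyticRank_of_analyticRank_le_one)
    (hS28 : bsdTriple_of_hasCM_of_L_one_ne_zero)
    (h46 : HatleyLei2019.thm46_etaSignedMu_eq_zero_iff_of_torsionIso) [Fact (5 : ℕ).Prime]
    (W' : WeierstrassCurve ℚ) (hW' : W' = ⟨0, 0, 0, 0, -125⟩) (hr' : W'.analyticRank = 0)
    (hs' : shaAn W' = ((1 : ℕ) : ℂ))
    (W : WeierstrassCurve ℚ) (hW : W = ⟨0, 0, 0, -8625, -644625⟩) (hr : W.analyticRank = 1) :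
    ∀ (V' : WeierstrassCurve ℚ) [V'.IsElliptic] [V'.IsGloballyMinimal]
      (V : WeierstrassCurve ℚ) [V.IsElliptic] [V.IsGloballyMinimal],
      (∃ C' : VariableChange ℚ, C' • W'.quadraticTwist (5) = V') →
      V'.HasGoodReductionAtPrime 5 → V'.frobeniusTrace 5 = 0 →
      (∃ C : VariableChange ℚ, C • W.quadraticTwist (5) = V) →
      V.HasGoodReductionAtPrime 5 → V.frobeniusTrace 5 = 0 →
      (∀ {N : ℕ} [NeZero N] {f : CuspForm (Gamma0 N) 2}, IsNewformOf V f →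
        ∀ (ϖ : ℚ), (if Even (5 / 2) then (ϖ : ℝ) * V.realPeriodRat = plusPeriod f
            else (ϖ : ℝ) * V.imaginaryPeriodRat = minusPeriod f) →
        ∀ (Lη : IwasawaAlgebra 5), IsQuadraticBranchPlusLFunction f 5 ϖ Lη →
          Ideal.span {Lη} = Ideal.span {(PowerSeries.X : IwasawaAlgebra 5)}) →
        QuadraticBranchPlusEtaMainConjectureAt V 5 := by
  intro V' _ _ V _ _ hC' hg' ha' hC hg ha hX
  have hcong : ModPCongruent V' V 5 := by
    subst hW'; subst hW
    haveI := EtaCMUnitRecords.isElliptic_3600bb1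
    haveI := EtaPrimeRoadRecords.isElliptic_104400dc1
    exact EtaModFiveCongruenceRecords.modPCongruent_twist5_3600bb1_104400dc1 hF _ _ rfl rfl V' V hC' hC
  exact EtaPrimeRoadRecordsByName.etaMC_r1_104400dc1_3600bb1_5 h22 h41 hmod hGZK hS28 h46 W' hW' hr' hs' W hW hr V' V hC' hg' ha' hC hg ha hcong hX

set_option maxRecDepth 100000 in
/-- **`etaMC_r1_243900o1_900b1_5_fisher`, the congruence from print** — the record
`EtaPrimeRoadRecordsByName.etaMC_r1_243900o1_900b1_5` (k8eta-c2 g4/g5: (C1⁺_η) at `p = 5` for every good `a_5 = 0` globally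
minimal model `V` of the `5`-twist of the non-CM rank-`1` row `243900o1`, through the CM unit anchor `900b1`, Hatley–Lei by
name) with its displayed binder `ModPCongruent V′ V 5` DISCHARGED for all models `V′`, `V` of the two `5`-twists:
`EtaModFiveCongruenceRecords.modPCongruent_twist5_900b1_243900o1 hF …` — the twisted row is the point `(λ:μ) = (600 : 1)` of the
INDIRECT Hesse family of the twisted anchor, `v = 1/590490000000000000000` (kernel certificate; models by `congr_of_smul_eq`).
So this row is settled per row modulo NAMED PUBLISHED FACTS ONLY (`h22 h41 h46 hmod hGZK hS28` + Fisher's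
`thm58_geomTorsionFive_of_dualHesseFamily`) + the displayed PARI shape `(L_5⁺(V,η,X)) = (X)` + Cremona's `r_an`, `#Ш_an`. Other
binders, conclusion and honest framing VERBATIM those of the original (CONDITIONAL; per row; nothing booked; BSD for no pair).
[cite: Fisher2013TwistsOfX5, Thm. 5.8] [cite: HatleyLei2019, Thm. 4.6 (§4.2)] [cite: Kobayashi2003, §4 (p. 8)]
[cite: Cremona1997, Table 1 (labels 243900o1, 900b1)] -/
theorem etaMC_r1_243900o1_900b1_5_fisher (hF : thm58_geomTorsionFive_of_dualHesseFamily)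
    (h22 : Kobayashi2003.thm22_etaSignedSelmerDual_finite_torsion)
    (h41 : Kobayashi2003.thm41_plusEtaCharIdeal_dvd)
    (hmod : hasEntireLFunction_rat) (hGZK : rank_eq_analyticRank_of_analyticRank_le_one)
    (hS28 : bsdTriple_of_hasCM_of_L_one_ne_zero)
    (h46 : HatleyLei2019.thm46_etaSignedMu_eq_zero_iff_of_torsionIso) [Fact (5 : ℕ).Prime]
    (W' : WeierstrassCurve ℚ) (hW' : W' = ⟨0, 0, 0, 0, 125⟩) (hr' : W'.analyticRank = 0)
    (hs' : shaAn W' = ((1 : ℕ) : ℂ))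
    (W : WeierstrassCurve ℚ) (hW : W = ⟨0, 0, 0, -2607000, -1503171500⟩) (hr : W.analyticRank = 1) :
    ∀ (V' : WeierstrassCurve ℚ) [V'.IsElliptic] [V'.IsGloballyMinimal]
      (V : WeierstrassCurve ℚ) [V.IsElliptic] [V.IsGloballyMinimal],
      (∃ C' : VariableChange ℚ, C' • W'.quadraticTwist (5) = V') →
      V'.HasGoodReductionAtPrime 5 → V'.frobeniusTrace 5 = 0 →
      (∃ C : VariableChange ℚ, C • W.quadraticTwist (5) = V) →
      V.HasGoodReductionAtPrime 5 → V.frobeniusTrace 5 = 0 →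
      (∀ {N : ℕ} [NeZero N] {f : CuspForm (Gamma0 N) 2}, IsNewformOf V f →
        ∀ (ϖ : ℚ), (if Even (5 / 2) then (ϖ : ℝ) * V.realPeriodRat = plusPeriod f
            else (ϖ : ℝ) * V.imaginaryPeriodRat = minusPeriod f) →
        ∀ (Lη : IwasawaAlgebra 5), IsQuadraticBranchPlusLFunction f 5 ϖ Lη →
          Ideal.span {Lη} = Ideal.span {(PowerSeries.X : IwasawaAlgebra 5)}) →
        QuadraticBranchPlusEtaMainConjectureAt V 5 := by
  intro V' _ _ V _ _ hC' hg' ha' hC hg ha hX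
  have hcong : ModPCongruent V' V 5 := by
    subst hW'; subst hW
    haveI := EtaCMUnitRecords.isElliptic_900b1
    haveI := EtaPrimeRoadRecords.isElliptic_243900o1
    exact EtaModFiveCongruenceRecords.modPCongruent_twist5_900b1_243900o1 hF _ _ rfl rfl V' V hC' hC
  exact EtaPrimeRoadRecordsByName.etaMC_r1_243900o1_900b1_5 h22 h41 hmod hGZK hS28 h46 W' hW' hr' hs' W hW hr V' V hC' hg' ha' hC hg ha hcong hX

set_option maxRecDepth 100000 in
/-- **`etaMC_r1_243900p1_900b1_5_fisher`, the congruence from print** — the record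
`EtaPrimeRoadRecordsByName.etaMC_r1_243900p1_900b1_5` (k8eta-c2 g4/g5: (C1⁺_η) at `p = 5` for every good `a_5 = 0` globally
minimal model `V` of the `5`-twist of the non-CM rank-`1` row `243900p1`, through the CM unit anchor `900b1`, Hatley–Lei by
name) with its displayed binder `ModPCongruent V′ V 5` DISCHARGED for all models `V′`, `V` of the two `5`-twists:
`EtaModFiveCongruenceRecords.modPCongruent_twist5_900b1_243900p1 hF …` — the twisted row is the point `(λ:μ) = (-1200 : 1)` of
the DIRECT Hesse family of the twisted anchor, `v = 1/174960000000000` (kernel certificate; models by `congr_of_smul_eq`). So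
this row is settled per row modulo NAMED PUBLISHED FACTS ONLY (`h22 h41 h46 hmod hGZK hS28` + Fisher's
`thm132_geomTorsionFive_of_hesseFamily`) + the displayed PARI shape `(L_5⁺(V,η,X)) = (X)` + Cremona's `r_an`, `#Ш_an`. Other
binders, conclusion and honest framing VERBATIM those of the original (CONDITIONAL; per row; nothing booked; BSD for no pair).
[cite: Fisher2012Hessian, Thm. 13.2 (i)] [cite: HatleyLei2019, Thm. 4.6 (§4.2)] [cite: Kobayashi2003, §4 (p. 8)]
[cite: Cremona1997, Table 1 (labels 243900p1, 900b1)] -/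
theorem etaMC_r1_243900p1_900b1_5_fisher (hF : thm132_geomTorsionFive_of_hesseFamily)
    (h22 : Kobayashi2003.thm22_etaSignedSelmerDual_finite_torsion)
    (h41 : Kobayashi2003.thm41_plusEtaCharIdeal_dvd)
    (hmod : hasEntireLFunction_rat) (hGZK : rank_eq_analyticRank_of_analyticRank_le_one)
    (hS28 : bsdTriple_of_hasCM_of_L_one_ne_zero)
    (h46 : HatleyLei2019.thm46_etaSignedMu_eq_zero_iff_of_torsionIso) [Fact (5 : ℕ).Prime]
    (W' : WeierstrassCurve ℚ) (hW' : W' = ⟨0, 0, 0, 0, 125⟩) (hr' : W'.analyticRank = 0)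
    (hs' : shaAn W' = ((1 : ℕ) : ℂ))
    (W : WeierstrassCurve ℚ) (hW : W = ⟨0, 0, 0, -23463000, 40585630500⟩) (hr : W.analyticRank = 1) :
    ∀ (V' : WeierstrassCurve ℚ) [V'.IsElliptic] [V'.IsGloballyMinimal]
      (V : WeierstrassCurve ℚ) [V.IsElliptic] [V.IsGloballyMinimal],
      (∃ C' : VariableChange ℚ, C' • W'.quadraticTwist (5) = V') →
      V'.HasGoodReductionAtPrime 5 → V'.frobeniusTrace 5 = 0 →
      (∃ C : VariableChange ℚ, C • W.quadraticTwist (5) = V) →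
      V.HasGoodReductionAtPrime 5 → V.frobeniusTrace 5 = 0 →
      (∀ {N : ℕ} [NeZero N] {f : CuspForm (Gamma0 N) 2}, IsNewformOf V f →
        ∀ (ϖ : ℚ), (if Even (5 / 2) then (ϖ : ℝ) * V.realPeriodRat = plusPeriod f
            else (ϖ : ℝ) * V.imaginaryPeriodRat = minusPeriod f) →
        ∀ (Lη : IwasawaAlgebra 5), IsQuadraticBranchPlusLFunction f 5 ϖ Lη →
          Ideal.span {Lη} = Ideal.span {(PowerSeries.X : IwasawaAlgebra 5)}) →
        QuadraticBranchPlusEtaMainConjectureAt V 5 := by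
  intro V' _ _ V _ _ hC' hg' ha' hC hg ha hX
  have hcong : ModPCongruent V' V 5 := by
    subst hW'; subst hW
    haveI := EtaCMUnitRecords.isElliptic_900b1
    haveI := EtaPrimeRoadRecords.isElliptic_243900p1
    exact EtaModFiveCongruenceRecords.modPCongruent_twist5_900b1_243900p1 hF _ _ rfl rfl V' V hC' hC
  exact EtaPrimeRoadRecordsByName.etaMC_r1_243900p1_900b1_5 h22 h41 hmod hGZK hS28 h46 W' hW' hr' hs' W hW hr V' V hC' hg' ha' hC hg ha hcong hX

set_option maxRecDepth 100000 in
/-- **`etaMC_r1_458100j1_900b1_5_fisher`, the congruence from print** — the record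
`EtaPrimeRoadRecordsByName.etaMC_r1_458100j1_900b1_5` (k8eta-c2 g4/g5: (C1⁺_η) at `p = 5` for every good `a_5 = 0` globally
minimal model `V` of the `5`-twist of the non-CM rank-`1` row `458100j1`, through the CM unit anchor `900b1`, Hatley–Lei by
name) with its displayed binder `ModPCongruent V′ V 5` DISCHARGED for all models `V′`, `V` of the two `5`-twists:
`EtaModFiveCongruenceRecords.modPCongruent_twist5_900b1_458100j1 hF …` — the twisted row is the point `(λ:μ) = (300 : 1)` of the
INDIRECT Hesse family of the twisted anchor, `v = 1/21870000000000000000` (kernel certificate; models by `congr_of_smul_eq`). So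
this row is settled per row modulo NAMED PUBLISHED FACTS ONLY (`h22 h41 h46 hmod hGZK hS28` + Fisher's
`thm58_geomTorsionFive_of_dualHesseFamily`) + the displayed PARI shape `(L_5⁺(V,η,X)) = (X)` + Cremona's `r_an`, `#Ш_an`. Other
binders, conclusion and honest framing VERBATIM those of the original (CONDITIONAL; per row; nothing booked; BSD for no pair).
[cite: Fisher2013TwistsOfX5, Thm. 5.8] [cite: HatleyLei2019, Thm. 4.6 (§4.2)] [cite: Kobayashi2003, §4 (p. 8)]
[cite: Cremona1997, Table 1 (labels 458100j1, 900b1)] -/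
theorem etaMC_r1_458100j1_900b1_5_fisher (hF : thm58_geomTorsionFive_of_dualHesseFamily)
    (h22 : Kobayashi2003.thm22_etaSignedSelmerDual_finite_torsion)
    (h41 : Kobayashi2003.thm41_plusEtaCharIdeal_dvd)
    (hmod : hasEntireLFunction_rat) (hGZK : rank_eq_analyticRank_of_analyticRank_le_one)
    (hS28 : bsdTriple_of_hasCM_of_L_one_ne_zero)
    (h46 : HatleyLei2019.thm46_etaSignedMu_eq_zero_iff_of_torsionIso) [Fact (5 : ℕ).Prime]
    (W' : WeierstrassCurve ℚ) (hW' : W' = ⟨0, 0, 0, 0, 125⟩) (hr' : W'.analyticRank = 0)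
    (hs' : shaAn W' = ((1 : ℕ) : ℂ))
    (W : WeierstrassCurve ℚ) (hW : W = ⟨0, 0, 0, -213033375, 1194190269750⟩) (hr : W.analyticRank = 1) :
    ∀ (V' : WeierstrassCurve ℚ) [V'.IsElliptic] [V'.IsGloballyMinimal]
      (V : WeierstrassCurve ℚ) [V.IsElliptic] [V.IsGloballyMinimal],
      (∃ C' : VariableChange ℚ, C' • W'.quadraticTwist (5) = V') →
      V'.HasGoodReductionAtPrime 5 → V'.frobeniusTrace 5 = 0 →
      (∃ C : VariableChange ℚ, C • W.quadraticTwist (5) = V) →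
      V.HasGoodReductionAtPrime 5 → V.frobeniusTrace 5 = 0 →
      (∀ {N : ℕ} [NeZero N] {f : CuspForm (Gamma0 N) 2}, IsNewformOf V f →
        ∀ (ϖ : ℚ), (if Even (5 / 2) then (ϖ : ℝ) * V.realPeriodRat = plusPeriod f
            else (ϖ : ℝ) * V.imaginaryPeriodRat = minusPeriod f) →
        ∀ (Lη : IwasawaAlgebra 5), IsQuadraticBranchPlusLFunction f 5 ϖ Lη →
          Ideal.span {Lη} = Ideal.span {(PowerSeries.X : IwasawaAlgebra 5)}) →
        QuadraticBranchPlusEtaMainConjectureAt V 5 := by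
  intro V' _ _ V _ _ hC' hg' ha' hC hg ha hX
  have hcong : ModPCongruent V' V 5 := by
    subst hW'; subst hW
    haveI := EtaCMUnitRecords.isElliptic_900b1
    haveI := EtaPrimeRoadRecords.isElliptic_458100j1
    exact EtaModFiveCongruenceRecords.modPCongruent_twist5_900b1_458100j1 hF _ _ rfl rfl V' V hC' hC
  exact EtaPrimeRoadRecordsByName.etaMC_r1_458100j1_900b1_5 h22 h41 hmod hGZK hS28 h46 W' hW' hr' hs' W hW hr V' V hC' hg' ha' hC hg ha hcong hX

end EtaPrimeRoadRecordsFisher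

end Summit.BirchSwinnertonDyer.BirchSwinnertonDyer.Theorems

end
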